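import Mathlib
import HarnessLib
import HarnessLib.Audit
import Summits.PneNP.Statement
import Literature.Computability.Complexity.Classes
import Literature.Computability.Complexity.Nondeterministic
import Literature.Computability.Complexity.CookBridges
import Literature.Computability.Complexity.ConstantDepth
import Literature.Computability.Complexity.KannanLanguage
import Literature.Computability.MetaComplexity.ChenJinWilliams2019.SparseConstantDepthMagnification

/-!
Route: RootDecompDepthTwoThreshold

DORMANT since 2026-09-04T12:43:13Z (reconciler: no traction for 5 d (last activity statement-checked at 2026-08-30T12:09:00Z); parked, not closed — `ledger route dormant route-PneNP-RootDecompDepthTwoThreshold --off` to reactivate) — unstaffed, not closed; items shared with open routes are served there. `ledger route dormant <id> --off` reactivates.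

# Route RootDecompDepthTwoThreshold — Root decomposition at the depth-two threshold cell — does
Algorithmica escape THR∘THR?

Root-decomposition cell decomp-pnenp, node N25 (lens-2 gen 8 «DepthTwoThreshold — THR∘THR as a
generic cut», HOME/decomp-pnenp-lens-2/DepthTwoThreshold.lean
sha256 fe100eea, NODE-g8.md adf48b10; critic decomp-pnenp-crit-1 g3 CLEARED 2026-08-30T06:59:36Z
with 0 blocking objections: the NEXT NOTCH of lens-2's
class-dial line under N4, scores once (vii); filing = LINE under N4 preferred, thin route
{TransferTHR2 r2, ShallowTHR2 r3} ADMISSIBLE NOW, OPTIONAL / LOW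
PRIORITY — N4 route-PneNP-RootDecompAccTransfer sits at the 15-item cap, so the thin route is the
only ledger vehicle). It suffices to show X = A ∧ R, the
law-D cut of S along Z := «P ⊆ THR∘THR», THR∘THR = LT₂ = polynomial-size depth-two circuits over ALL
integer-weight linear threshold gates (tree
`DepthSizeClass ltfBasis (fun _ => 2) (p.eval)`): A = `TransferTHR2` (NP ⊆ P → P ⊄ THR∘THR,
«Algorithmica has a polynomial-time language outside THR∘THR»;
crux r2, ATTACKED) and R = `ShallowTHR2` (NP ⊆ P → P ⊆ THR∘THR; crux r3, DECLARED RESIDUAL,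
pre-costume declared). S ↔ A ∧ R hypothesis-free (writer
certificate `node_iff`; lens generic `cut_iff C` for every class C with both costume ends in
kernel). No card realised (cell node).
Lean: `(Literature.Computability.Complexity.Nondeterministic.NP ⊆
Literature.Computability.Complexity.Classes.P → ¬ (Literature.Computability.Complexity.Classes.P ⊆
{L : Language Bool | ∃ p : Polynomial ℕ, L ∈ Literature.Computability.Complexity.DepthSizeClass
Literature.Computability.MetaComplexity.ChenJinWilliams2019.ltfBasis (fun _ : ℕ => 2) (fun n : ℕ =>
p.eval n)})) ∧ (Literature.Computability.Complexity.Nondeterministic.NP ⊆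
Literature.Computability.Complexity.Classes.P → Literature.Computability.Complexity.Classes.P ⊆ {L :
Language Bool | ∃ p : Polynomial ℕ, L ∈ Literature.Computability.Complexity.DepthSizeClass
Literature.Computability.MetaComplexity.ChenJinWilliams2019.ltfBasis (fun _ : ℕ => 2) (fun n : ℕ =>
p.eval n)})`

Rationale: WHY THIS LINE. The mechanism is the class-cell schema of N4 (ACC⁰ / MAJ / TC⁰ cells), N10 (⊕P), N22
(depth 3), N26 (L/poly) — cut S along «Algorithmica escapes class C»
— at the ONE OPEN RUNG of the Williams ladder itself: C = THR∘THR, unbounded weights on both levels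
(Jukna2012 §11.10 p.340 «we cannot prove strong lower
bounds on unbounded-weight threshold circuits of depth 2», Research Problem 11.41 p.343; Amano 2020
«we cannot refute that every function in NEXP has
polynomial-size THR∘THR circuits»). What is imported: from threshold-circuit complexity the DECIDED
RUNGS around the cell, all theorems in the tree or the
lens kernel — depth d = 1 (IP on two pairs is not an LTF, kernel `not_isLTF_ip2`), d = 3 (IPₙ has
2n+1-gate LTF circuits, tree
`exists_thresholdCircuit_innerProduct`), bottom weight ≤ W (Forster 2002 / Jukna Thm 11.38, tree
`Jukna2012_thm1138_sqrt`), MAJ∘THR (Hajnal et al. 1993 /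
Jukna Thm 11.37, tree `Jukna2012_thm1137`), linear size (Gröger–Turán 1991, tree
`GrogerTuran1991_innerProduct_ltf`), print n^(3/2) gates (Kane–Williams 2016,
arXiv:1511.07860 Thm 1.1); from structural complexity the collapse transfer (Kannan 1982 cells
inside Algorithmica, as in N26). The cell is linked to N4 IN
KERNEL modulo the print binder THR∘THR ⊆ TC⁰ (GHR92): A ⟸ N4.ThresholdTransfer 26497 and R ⟹
N4.ThresholdShallow 26499 / ResidualStar 26496
(`transferTHR2_of_thresholdTransfer`, `thresholdShallow_of_shallowTHR2`,
`residualStar_of_shallowTHR2`), so R is STRONGER than N4's residual of record and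
is LOGGED on N4's class line, not scored. S-free roads of A, typed in the lens and OPEN: IPL ∉
THR∘THR (Jukna RP 11.41 in language form; `IPL ∈ P` in kernel
via a 4-state transducer), P ⊄ THR∘THR, NEXP ⊄ THR∘THR (filed as aside), NQP ⊄ THR∘THR; win-win `MAJ
∈ ACC⁰ → NQP ⊄ THR∘THR` (Murray–Williams /
Chen–Tell) joins it to N4's MAJORITY cut. What no prior route / negatives entry does: no route is
typed over `ltfBasis` depth 2; N4's cells are ACC⁰ /
MAJ / TC⁰ (THR∘THR ⊆ TC⁰ strictly finer); `ledger negatives --problem PneNP` has no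
threshold-depth-2 statement.

RANKED CRUXES. #2 TransferTHR2 (crux) — PIECE A (attacked): if SAT is in P then some polynomial-time
language has no polynomial-size depth-two unbounded-weight threshold circuits. Failure world exactly
NP ⊆ P ∧ P ⊆ THR∘THR (lens `not_transferTHR2_iff`), refuted by no theorem; S-free roads IPL ∉
THR∘THR / P ⊄ THR∘THR / NEXP ⊄ THR∘THR; A ⟸ N4.ThresholdTransfer mod THR∘THR ⊆ TC⁰. [difficulty:
open-problem] (why it might fail: False exactly if P = NP and P ⊆ THR∘THR; no lower bound beyond
n^(3/2) gates is known for depth-2 unbounded-weight threshold circuits even for NEXP (Kane–Williams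
2016, Amano 2020), and sign-rank methods provably stop at THR∘MAJ.) [Jukna2012, arXiv:1511.07860,
Forster2002, HOME/decomp-pnenp-lens-2/DepthTwoThreshold.lean sha256 fe100eea]
#3 ShallowTHR2 (crux) — PIECE R (DECLARED RESIDUAL, pre-costume declared): were SAT easy, every
polynomial-time language would have polynomial-size THR∘THR circuits; natively «P ⊄ THR∘THR ⟹ P ≠
NP». R ⟹ N4.ThresholdShallow 26499 and ResidualStar 26496 mod THR∘THR ⊆ TC⁰ (stronger than N4's
residual of record; logged on N4's class line, no residual score). PRE-COSTUME: one explicit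
P-language outside THR∘THR makes R ≡ S (lens `shallowTHR2_iff_pneNP_of_pNotTHR2`). [deps:
TransferTHR2] [difficulty: open-problem] (why it might fail: False exactly in the world «P = NP and
some P-language needs super-polynomial THR∘THR circuits»; the second conjunct (Jukna RP 11.41 for a
P-function, e.g. IP) is widely expected TRUE, so R is expected to carry the whole summit
(pre-costume).) [Jukna2012, GoldmannHastadRazborov1992, arXiv:1511.07860,
HOME/decomp-pnenp-lens-2/DepthTwoThreshold.lean sha256 fe100eea]
#9 THRTHRSubsetTC0 (support) — (filed kind ASIDE — print binder, GHR92: THR∘THR ⊆ MAJ∘MAJ∘MAJ ⊆ TC⁰)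
the inclusion THR∘THR ⊆ TC⁰ over the tree classes; it is the ONE binder of the kernel links to N4
(26496/26497/26499). Provable by porting Goldmann–Håstad–Razborov 1992 against the tree's
`DepthSizeClass` (not yet in the tree as a theorem). [difficulty: M] (why it might fail: n/a
(theorem in print; formalisation debt only).) [GoldmannHastadRazborov1992, Jukna2012]
#9 NEXPNotTHR2 (support) — (filed kind ASIDE — S-free ROAD above A, OPEN in print: Amano 2020 §1,
Kane–Williams 2016) NEXP ⊄ THR∘THR; implied by P ⊄ THR∘THR (lens `nexpNotTHR2_of_pNotTHR2`), the
weakest uniform separation on this dial; recorded so the census can track the road without re-typing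
it. [difficulty: open-problem] (why it might fail: open; even NEXP vs THR∘THR is unrefuted (Amano
2020), the Williams programme reaches ACC⁰∘THR but not THR∘THR.) [arXiv:1511.07860, Jukna2012]

TWO-LAYER PLAN. A's foreseen glued split (tenure, not now): A ⟸ PNotTHR2 «P ⊄ THR∘THR» ⟸ IPLNotTHR2
«IPL ∉ THR∘THR» (lens kernels `transferTHR2_of_pNotTHR2`, `transferTHR2_of_iplNotTHR2`); finite form
IPFinNotTHR2 + slice bridge. R is not decomposed (residual).

KILL CRITERIA. A refuted ⟺ someone proves NP ⊆ P ∧ P ⊆ THR∘THR (absurdly strong) — practically: the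
route is retired `not-a-thesis` if the critic/tribunal rules the cell a duplicate of N4's TC⁰ cell
(it is strictly finer: THR∘THR ⊆ TC⁰), or superseded if a P-language outside THR∘THR is PROVED (then
R ≡ S, pre-costume fires, and A closes outright — the node collapses to the summit and is retired as
costume).

NOT DECOMPOSED YET. R (residual) — no decomposition is offered; the roads of A are typed in the lens
but filed only as the aside NEXPNotTHR2 (IPL needs a Literature definition of the inner-product
language before IPLNotTHR2 can be an item).

CHEAPEST FALSIFIER. `exact?` / `#h21_crux_probe` on A and R against PneNP (run: both CLEAN, C→S and
S→C fail); literature check that THR∘THR lower bounds for an explicit P-function are still open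
(Jukna2012 p.340/343, Amano 2020, Kane–Williams 2016: yes, open beyond n^1.5 gates).

Novelty: Searches RUN (lens g8 + writer): `lean search 'ltfBasis'`, `lean search 'DepthSizeClass'` (tree
classes exist, no depth-2 route), `ledger negatives --problem PneNP` (no THR statement), lit search
"depth-two threshold circuits unbounded weights lower bound" [corpus:book:jukna2012 p.340, p.343],
galaxy "THR∘THR|depth-two threshold" [galaxy:panama:444700913827904 Amano 2020], arXiv:1511.07860
(Kane–Williams). Nearest prior art: N4 route-PneNP-RootDecompAccTransfer (TC⁰ / MAJ cells; delta =
the strictly finer class THR∘THR = the Williams ladder's own open rung, with the full decided rung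
table depth/weight/size typed around it); N26 (L/poly cell, incomparable class). Delta in one
sentence: the first cell of the class dial whose S-free road is a named Research Problem (Jukna
11.41) with every neighbouring rung a theorem in the tree. Claimed grade: variant → new-combination
(critic g3).  [refs: 1511.07860, book:jukna2012]

Barriers (technique_class: threshold-circuits, law-D-carving, collapse-transfer): - technique_class: threshold-circuits, law-D-carving, collapse-transfer
- Literature.Barriers.PneNP.Relativization: R inside (relativizing arguments cannot prove R: P = NP
oracle worlds with P ⊄ THR∘THR-type separations exist); A's roads are circuit lower bounds, outside
relativization's scope.
- Literature.Barriers.PneNP.NaturalProofs: A's S-free road (explicit function outside THR∘THR) is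
INSIDE conditionally — natural proofs useful against THR∘THR ⊆ TC⁰ break pseudorandom functions in
TC⁰ (Naor–Reingold) — the bet is a non-natural argument (e.g. Williams-style algorithmic method,
which reaches ACC⁰∘THR) or the collapse NP ⊆ P itself as the non-natural ingredient (Kannan cells
are diagonal, not natural).
- Literature.Barriers.PneNP.SubmodularMeasures: not this class (no formula-size measure is used);
the sign-rank / discrepancy methods that decide the weight rungs provably stop at THR∘MAJ
(Chattopadhyay–Mande 2018), recorded as the method ceiling of the road, not a catalogued barrier
decl.

History (route lifecycle, newest last):
- 2026-09-04T12:43:13Z · DORMANT — reconciler: no traction for 5 d (last activity statement-checked at 2026-08-30T12:09:00Z); parked, not closed — `ledger route dormant route-PneNP-RootDecompDept (operator:999:2532259)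

sub-problem: PneNP · status: dormant · opened planner-decomp-pnenp-writer-1-g4-0 2026-08-30T07:46:48Z · rev 0 · ledger route-PneNP-RootDecompDepthTwoThreshold
GENERATED by the gate from the ledger (D-0016/17). Provers cite these decls: `theorem foo : Summit.PneNP.PneNP.Theses.RootDecompDepthTwoThreshold.<Decl> := …` in Summits/PneNP/PneNP/Theorems/<Name>.lean.
-/

namespace Summit.PneNP.PneNP.Theses.RootDecompDepthTwoThreshold

open scoped BigOperators Topology Manifold Classical MeasureTheory ProbabilityTheory Matrix InnerProductSpace ComplexConjugate ContinuousMap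
open Filter Set Function TopologicalSpace MeasureTheory

attribute [summit_statement] _root_.PneNP

open Literature.PNP

/-- item stmt-PneNP-30450 · crux · rank 2 · open · by planner
why it might fail: False exactly if P = NP and P ⊆ THR∘THR; no lower bound beyond n^(3/2) gates is known for depth-2 unbounded-weight threshold circuits even for NEXP (Kane–Williams 2016, Amano 2020), and sign-rank methods provably stop at THR∘MAJ.
sources: Jukna2012, arXiv:1511.07860, Forster2002, HOME/decomp-pnenp-lens-2/DepthTwoThreshold.lean sha256 fe100eea
[crux] PIECE A (attacked): if SAT is in P then some polynomial-time language has no polynomial-size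
depth-two unbounded-weight threshold circuits. Failure world exactly NP ⊆ P ∧ P ⊆ THR∘THR (lens
`not_transferTHR2_iff`), refuted by no theorem; S-free roads IPL ∉ THR∘THR / P ⊄ THR∘THR / NEXP ⊄
THR∘THR; A ⟸ N4.ThresholdTransfer mod THR∘THR ⊆ TC⁰. [difficulty: open-problem] -/
@[route_item "route-PneNP-RootDecompDepthTwoThreshold"]
def TransferTHR2 : Prop :=
  Literature.Computability.Complexity.Nondeterministic.NP ⊆ Literature.Computability.Complexity.Classes.P → ¬ (Literature.Computability.Complexity.Classes.P ⊆ {L : Language Bool | ∃ p : Polynomial ℕ, L ∈ Literature.Computability.Complexity.DepthSizeClass Literature.Computability.MetaComplexity.ChenJinWilliams2019.ltfBasis (fun _ : ℕ => 2) (fun n : ℕ => p.eval n)})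

/-- item stmt-PneNP-30451 · crux · rank 3 · open · by planner
why it might fail: False exactly in the world «P = NP and some P-language needs super-polynomial THR∘THR circuits»; the second conjunct (Jukna RP 11.41 for a P-function, e.g. IP) is widely expected TRUE, so R is expected to carry the whole summit (pre-costume).
sources: Jukna2012, GoldmannHastadRazborov1992, arXiv:1511.07860, HOME/decomp-pnenp-lens-2/DepthTwoThreshold.lean sha256 fe100eea
[crux] PIECE R (DECLARED RESIDUAL, pre-costume declared): were SAT easy, every polynomial-time
language would have polynomial-size THR∘THR circuits; natively «P ⊄ THR∘THR ⟹ P ≠ NP». R ⟹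
N4.ThresholdShallow 26499 and ResidualStar 26496 mod THR∘THR ⊆ TC⁰ (stronger than N4's residual of
record; logged on N4's class line, no residual score). PRE-COSTUME: one explicit P-language outside
THR∘THR makes R ≡ S (lens `shallowTHR2_iff_pneNP_of_pNotTHR2`). [deps: TransferTHR2] [difficulty:
open-problem] -/
@[route_item "route-PneNP-RootDecompDepthTwoThreshold"]
def ShallowTHR2 : Prop :=
  Literature.Computability.Complexity.Nondeterministic.NP ⊆ Literature.Computability.Complexity.Classes.P → Literature.Computability.Complexity.Classes.P ⊆ {L : Language Bool | ∃ p : Polynomial ℕ, L ∈ Literature.Computability.Complexity.DepthSizeClass Literature.Computability.MetaComplexity.ChenJinWilliams2019.ltfBasis (fun _ : ℕ => 2) (fun n : ℕ => p.eval n)}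

/-- item stmt-PneNP-30452 · aside · rank 9 · open · by planner
why it might fail: n/a (theorem in print; formalisation debt only).
sources: GoldmannHastadRazborov1992, Jukna2012
[aside] [support] (filed kind ASIDE — print binder, GHR92: THR∘THR ⊆ MAJ∘MAJ∘MAJ ⊆ TC⁰) the
inclusion THR∘THR ⊆ TC⁰ over the tree classes; it is the ONE binder of the kernel links to N4
(26496/26497/26499). Provable by porting Goldmann–Håstad–Razborov 1992 against the tree's
`DepthSizeClass` (not yet in the tree as a theorem). [difficulty: M] -/
@[route_item "route-PneNP-RootDecompDepthTwoThreshold"]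
def THRTHRSubsetTC0 : Prop :=
  {L : Language Bool | ∃ p : Polynomial ℕ, L ∈ Literature.Computability.Complexity.DepthSizeClass Literature.Computability.MetaComplexity.ChenJinWilliams2019.ltfBasis (fun _ : ℕ => 2) (fun n : ℕ => p.eval n)} ⊆ Literature.Computability.Complexity.TC0

/-- item stmt-PneNP-30453 · aside · rank 9 · open · by planner
why it might fail: open; even NEXP vs THR∘THR is unrefuted (Amano 2020), the Williams programme reaches ACC⁰∘THR but not THR∘THR.
sources: arXiv:1511.07860, Jukna2012
[aside] [support] (filed kind ASIDE — S-free ROAD above A, OPEN in print: Amano 2020 §1,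
Kane–Williams 2016) NEXP ⊄ THR∘THR; implied by P ⊄ THR∘THR (lens `nexpNotTHR2_of_pNotTHR2`), the
weakest uniform separation on this dial; recorded so the census can track the road without re-typing
it. [difficulty: open-problem] -/
@[route_item "route-PneNP-RootDecompDepthTwoThreshold"]
def NEXPNotTHR2 : Prop :=
  ¬ (Literature.Computability.Complexity.NEXP ⊆ {L : Language Bool | ∃ p : Polynomial ℕ, L ∈ Literature.Computability.Complexity.DepthSizeClass Literature.Computability.MetaComplexity.ChenJinWilliams2019.ltfBasis (fun _ : ℕ => 2) (fun n : ℕ => p.eval n)})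

/-- item stmt-PneNP-30454 · assembly · rank 1 · open · by planner
[assembly] the two pieces give the summit (pure logic; deciding theorem `closes` in glue.lean,
hypothesis-free: assume ¬S, then NP ⊆ P by Cook's shape, A gives P ⊄ THR∘THR, R gives P ⊆ THR∘THR). -/
@[route_item "route-PneNP-RootDecompDepthTwoThreshold"]
def Assembly : Prop :=
  TransferTHR2 → ShallowTHR2 → PneNP

/-! D-0027 §2.1 — DECIDING THEOREM (planner-authored via `route open/edit --closes-file`; by planner-decomp-pnenp-writer-1-g4-0 2026-08-30T07:46:48Z):
its hypotheses are this route's items and its conclusion the sub-problem Statement (glue_lint), and it elaborates with this file. -/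

@[closes "route-PneNP-RootDecompDepthTwoThreshold"] theorem closes (hA : TransferTHR2) (hR : ShallowTHR2) : _root_.PneNP := by
  by_contra hS
  have hPNP : Literature.Computability.Complexity.Classes.P = Literature.Computability.Complexity.Nondeterministic.NP := by
    by_contra hne
    exact hS (Literature.Computability.Complexity.pneNP_shape_iff_P_ne_NP.2 hne)
  have hNP : Literature.Computability.Complexity.Nondeterministic.NP ⊆ Literature.Computability.Complexity.Classes.P := fun L hL => by rw [hPNP]; exact hL
  exact hA hNP (hR hNP)

end Summit.PneNP.PneNP.Theses.RootDecompDepthTwoThreshold
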